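import Summits.CriticalPhenomena.PercolationContinuityZ3.Theorems.PercNearOneGluingAdditiveGluingConeDoubleDriftChain
import Summits.CriticalPhenomena.PercolationContinuityZ3.Theorems.PercNearOneGluingAdditiveGluingConeAssembly
import Summits.CriticalPhenomena.PercolationContinuityZ3.Theorems.PercNearOneGluingAdditiveGluingBlockGoodLeaves
import Summits.CriticalPhenomena.PercolationContinuityZ3.Theorems.PercNearOneGluingAdditiveGluingSigmaRecursion
import HarnessLib

/-! # Crux `PercNearOneGluing.AdditiveGluing` (stmt-CriticalPhenomena-4576), line `peel` — skeleton v4's REAL part: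
# the cone step from BYSTANDER ATTACHMENT and the DOUBLE-DRIFT residual (part 2/2)

Lead c5; lands `--supports stmt-CriticalPhenomena-4576`.  No definitions, no named facts.  CONDITIONAL on two spelled-out hypotheses:
`bystanderGood` (for any designation `d ≠ x`: `insert x T` is `d`-good in `u` as soon as every layer block `T ∪ B` of positive layer
mass is `d`-good in the star-killed weighting `u − x` — proved in work/BystanderGood.lean from the landed σ-identities
`stub_bystanderReach/Designated/Pockets_c5`, registered handle `stub_bystanderGood_c5`) and `coneDoubleDrift` (the registered residual
`stub_coneDoubleDrift`: the cone growth step when for EVERY non-isolated vertex `x'` of `insert x T` every minimiser `a'` of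
`μ_{u−x'}(· ↔ b)` strictly overtakes `a₀` after gluing `insert x T`, with the `a'`-goodness of the block for every such pair handed in).
Part 1: a block containing the target is good; the cone chain inside one weighting (`coneDD_chain_local`).  Part 2: `coneDD_conePeel_of`
(strong induction on the number of positive-degree vertices; bystander route through every vertex of the block; isolated bystander;
Lemma-5 leaf `blockGood_leaf_lemma5`; drift split) the content theorem
`coneDD_conePeel_of : bystanderGood → coneDoubleDrift → conePeel` (registration handle of part 2: `stub_coneDDStarKill_c5`); the crux by
name is then `coneLine_additiveGluing_of (coneDD_conePeel_of h₁ h₂)` (landed …ConeAssembly.lean).  Numerics (lead c5, exact engine, n ≤ 8): total double drift in ≈ 0.1 % of bad instances, 0 violations.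
[cite: KozmaNitzan2024, §3.2 Definition p. 12, Thms 4–5 pp. 12–14, Lemma 5 p. 13, Question 7 & 9 p. 36]
-/

namespace Summit.CriticalPhenomena.PercolationContinuityZ3.Theorems

open MeasureTheory Set
open Literature.Probability.LatticeModels (prodBernoulli)
open Literature.Probability.Percolation (BondConfig openConn openConnIn openGraph openCluster)
open scoped BigOperators Classical

noncomputable section

variable {n : ℕ}

/-- **The cone step from bystander attachment and the double-drift stub** (strong induction on the number of positive-degree
vertices).  Isolated bystander: the only positive layer is `B = ∅` and `u − x = u`.  Otherwise, for EVERY non-isolated vertex `x'` of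
`insert x T` and every minimiser `a'` of `μ_{u−x'}(· ↔ b)`, every layer block `((insert x T).erase x') ∪ B` is `a'`-good in `u − x'`
(target inside: trivial; a vertex at least as reliable as `a'`: the Lemma-5 leaf; all below `a'`: the cone chain in `u − x'`, whose
steps are induction-hypothesis instances), so `insert x T` is `a'`-good in `u`; if for one such pair `τ_{u/(T∪x)}(a₀) ≤ τ_{u/(T∪x)}(a')`
we are done, else the double-drift stub applies. [cite: KozmaNitzan2024, §3.2 pp. 12–14] -/
theorem coneDD_conePeel_of
    (hInsert : ∀ (n : ℕ) (u : Sym2 (Fin n) → unitInterval) (A T : Finset (Fin n)) (x b d : Fin n) (hb : b ∈ A),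
      x ∉ T → x ∉ A → d ≠ x →
      (∀ B : Finset (Fin n),
        (prodBernoulli u).real
          {ω : BondConfig (Fin n) | ∀ y : Fin n, y ∈ B ↔ (y ∉ ({x} : Finset (Fin n)) ∧
            ∃ o ∈ ({x} : Finset (Fin n)), s(o, y) ∈ ω)} ≠ 0 →
        (prodBernoulli (fun e : Sym2 (Fin n) => if (∃ y ∈ e, y ∈ ({x} : Finset (Fin n))) then (0 : unitInterval) else u e)).real (openConn d b)
          + (prodBernoulli (fun e : Sym2 (Fin n) => if (∃ y ∈ e, y ∈ ({x} : Finset (Fin n))) then (0 : unitInterval) else u e)).real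
              ((openConn d b)ᶜ ∩ (⋃ v ∈ T ∪ B, openConn d v) ∩ (⋃ v ∈ T ∪ B, openConn v b))
        ≤ (prodBernoulli (fun e : Sym2 (Fin n) => if (∃ y ∈ e, y ∈ ({x} : Finset (Fin n))) then (0 : unitInterval) else u e)).real (⋃ v ∈ T ∪ B, openConn v b)
          + (∑ W ∈ (Finset.univ : Finset (Finset (Fin n))).filter (fun W => Disjoint W A),
              (prodBernoulli (fun e : Sym2 (Fin n) => if (∃ y ∈ e, y ∈ ({x} : Finset (Fin n))) then (0 : unitInterval) else u e)).real
                  {ω : BondConfig (Fin n) | ∀ z : Fin n, (z ∈ W ↔ ω ∈ ⋃ v ∈ T ∪ B, openConn v z)}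
                * A.inf' ⟨b, hb⟩ (fun a => (prodBernoulli (fun e : Sym2 (Fin n) => if (∃ y ∈ e, y ∈ ({x} : Finset (Fin n))) then (0 : unitInterval) else u e)).real (openConnIn ((W : Set (Fin n))ᶜ) a b)))) →
      (prodBernoulli u).real (openConn d b)
          + (prodBernoulli u).real
              ((openConn d b)ᶜ ∩ (⋃ v ∈ insert x T, openConn d v) ∩ (⋃ v ∈ insert x T, openConn v b))
        ≤ (prodBernoulli u).real (⋃ v ∈ insert x T, openConn v b)
          + (∑ W ∈ (Finset.univ : Finset (Finset (Fin n))).filter (fun W => Disjoint W A),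
              (prodBernoulli u).real
                  {ω : BondConfig (Fin n) | ∀ z : Fin n, (z ∈ W ↔ ω ∈ ⋃ v ∈ insert x T, openConn v z)}
                * A.inf' ⟨b, hb⟩ (fun a => (prodBernoulli u).real (openConnIn ((W : Set (Fin n))ᶜ) a b))))
    (hDD : ∀ (n : ℕ) (u : Sym2 (Fin n) → unitInterval) (A T : Finset (Fin n)) (b a₀ x : Fin n) (hb : b ∈ A),
      Disjoint T A → T.Nonempty → x ∉ A → x ∉ T → a₀ ∈ A → 4 ≤ A.card →
      (∀ a ∈ A, (prodBernoulli u).real (openConn a₀ b) ≤ (prodBernoulli u).real (openConn a b)) →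
      (∀ v ∈ insert x T, (prodBernoulli u).real (openConn v b) < (prodBernoulli u).real (openConn a₀ b)) →
      (∀ w' : Sym2 (Fin n) → unitInterval,
        (Finset.univ.filter (fun v : Fin n => ∃ y : Fin n, 0 < (w' s(y, v) : ℝ))).card
          ≤ (Finset.univ.filter (fun v : Fin n => ∃ y : Fin n, 0 < (u s(y, v) : ℝ))).card →
        ∀ (A' : Finset (Fin n)) (o' b' : Fin n), b' ∈ A' → o' ∉ A' →
        ∀ (t : ℝ) (sel : Finset (Fin n) → Fin n), (∀ W, sel W ∈ A') →
          (∀ a ∈ A', 1 - t ≤ (prodBernoulli w').real (openConn a b')) →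
          (prodBernoulli w').real ((⋃ a ∈ A', openConn o' a) ∩ (openConn o' b')ᶜ)
            + ∑ W ∈ (Finset.univ : Finset (Finset (Fin n))).filter (fun W => o' ∈ W ∧ Disjoint W A'),
                (prodBernoulli w').real {ω : BondConfig (Fin n) | openCluster ω o' = (W : Set (Fin n))}
                  * (prodBernoulli w').real (openConnIn ((W : Set (Fin n))ᶜ) (sel W) b')ᶜ
            ≤ t) →
      (prodBernoulli u).real (openConn a₀ b)
          + (prodBernoulli u).real
              ((openConn a₀ b)ᶜ ∩ (⋃ v ∈ T, openConn a₀ v) ∩ (⋃ v ∈ T, openConn v b))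
        ≤ (prodBernoulli u).real (⋃ v ∈ T, openConn v b)
          + (∑ W ∈ (Finset.univ : Finset (Finset (Fin n))).filter (fun W => Disjoint W A),
              (prodBernoulli u).real
                  {ω : BondConfig (Fin n) | ∀ z : Fin n, (z ∈ W ↔ ω ∈ ⋃ v ∈ T, openConn v z)}
                * A.inf' ⟨b, hb⟩ (fun a => (prodBernoulli u).real (openConnIn ((W : Set (Fin n))ᶜ) a b))) →
      (∀ x' ∈ insert x T, ∀ y₀ : Fin n, (u s(x', y₀) : ℝ) ≠ 0 → ∀ a' ∈ A,
        (∀ a ∈ A, (prodBernoulli (fun e : Sym2 (Fin n) => if (∃ y ∈ e, y ∈ ({x'} : Finset (Fin n))) then (0 : unitInterval) else u e)).real (openConn a' b) ≤ (prodBernoulli (fun e : Sym2 (Fin n) => if (∃ y ∈ e, y ∈ ({x'} : Finset (Fin n))) then (0 : unitInterval) else u e)).real (openConn a b)) →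
        (prodBernoulli u).real (openConn a' b)
            + (prodBernoulli u).real ((openConn a' b)ᶜ ∩ (⋃ v ∈ insert x T, openConn a' v) ∩ (⋃ v ∈ insert x T, openConn v b))
          < (prodBernoulli u).real (openConn a₀ b)
            + (prodBernoulli u).real ((openConn a₀ b)ᶜ ∩ (⋃ v ∈ insert x T, openConn a₀ v) ∩ (⋃ v ∈ insert x T, openConn v b))) →
      (∀ x' ∈ insert x T, ∀ y₀ : Fin n, (u s(x', y₀) : ℝ) ≠ 0 → ∀ a' ∈ A,
        (∀ a ∈ A, (prodBernoulli (fun e : Sym2 (Fin n) => if (∃ y ∈ e, y ∈ ({x'} : Finset (Fin n))) then (0 : unitInterval) else u e)).real (openConn a' b) ≤ (prodBernoulli (fun e : Sym2 (Fin n) => if (∃ y ∈ e, y ∈ ({x'} : Finset (Fin n))) then (0 : unitInterval) else u e)).real (openConn a b)) →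
        (prodBernoulli u).real (openConn a' b)
          + (prodBernoulli u).real
              ((openConn a' b)ᶜ ∩ (⋃ v ∈ insert x T, openConn a' v) ∩ (⋃ v ∈ insert x T, openConn v b))
        ≤ (prodBernoulli u).real (⋃ v ∈ insert x T, openConn v b)
          + (∑ W ∈ (Finset.univ : Finset (Finset (Fin n))).filter (fun W => Disjoint W A),
              (prodBernoulli u).real
                  {ω : BondConfig (Fin n) | ∀ z : Fin n, (z ∈ W ↔ ω ∈ ⋃ v ∈ insert x T, openConn v z)}
                * A.inf' ⟨b, hb⟩ (fun a => (prodBernoulli u).real (openConnIn ((W : Set (Fin n))ᶜ) a b)))) →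
      (prodBernoulli u).real (openConn a₀ b)
          + (prodBernoulli u).real
              ((openConn a₀ b)ᶜ ∩ (⋃ v ∈ insert x T, openConn a₀ v) ∩ (⋃ v ∈ insert x T, openConn v b))
        ≤ (prodBernoulli u).real (⋃ v ∈ insert x T, openConn v b)
          + (∑ W ∈ (Finset.univ : Finset (Finset (Fin n))).filter (fun W => Disjoint W A),
              (prodBernoulli u).real
                  {ω : BondConfig (Fin n) | ∀ z : Fin n, (z ∈ W ↔ ω ∈ ⋃ v ∈ insert x T, openConn v z)}
                * A.inf' ⟨b, hb⟩ (fun a => (prodBernoulli u).real (openConnIn ((W : Set (Fin n))ᶜ) a b)))) :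
    ∀ (n : ℕ) (u : Sym2 (Fin n) → unitInterval) (A T : Finset (Fin n)) (b a₀ x : Fin n) (hb : b ∈ A),
      Disjoint T A → T.Nonempty → x ∉ A → x ∉ T → a₀ ∈ A → 4 ≤ A.card →
      (∀ a ∈ A, (prodBernoulli u).real (openConn a₀ b) ≤ (prodBernoulli u).real (openConn a b)) →
      (∀ v ∈ insert x T, (prodBernoulli u).real (openConn v b) < (prodBernoulli u).real (openConn a₀ b)) →
      (∀ w' : Sym2 (Fin n) → unitInterval,
        (Finset.univ.filter (fun v : Fin n => ∃ y : Fin n, 0 < (w' s(y, v) : ℝ))).card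
          ≤ (Finset.univ.filter (fun v : Fin n => ∃ y : Fin n, 0 < (u s(y, v) : ℝ))).card →
        ∀ (A' : Finset (Fin n)) (o' b' : Fin n), b' ∈ A' → o' ∉ A' →
        ∀ (t : ℝ) (sel : Finset (Fin n) → Fin n), (∀ W, sel W ∈ A') →
          (∀ a ∈ A', 1 - t ≤ (prodBernoulli w').real (openConn a b')) →
          (prodBernoulli w').real ((⋃ a ∈ A', openConn o' a) ∩ (openConn o' b')ᶜ)
            + ∑ W ∈ (Finset.univ : Finset (Finset (Fin n))).filter (fun W => o' ∈ W ∧ Disjoint W A'),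
                (prodBernoulli w').real {ω : BondConfig (Fin n) | openCluster ω o' = (W : Set (Fin n))}
                  * (prodBernoulli w').real (openConnIn ((W : Set (Fin n))ᶜ) (sel W) b')ᶜ
            ≤ t) →
      (prodBernoulli u).real (openConn a₀ b)
          + (prodBernoulli u).real
              ((openConn a₀ b)ᶜ ∩ (⋃ v ∈ T, openConn a₀ v) ∩ (⋃ v ∈ T, openConn v b))
        ≤ (prodBernoulli u).real (⋃ v ∈ T, openConn v b)
          + (∑ W ∈ (Finset.univ : Finset (Finset (Fin n))).filter (fun W => Disjoint W A),
              (prodBernoulli u).real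
                  {ω : BondConfig (Fin n) | ∀ z : Fin n, (z ∈ W ↔ ω ∈ ⋃ v ∈ T, openConn v z)}
                * A.inf' ⟨b, hb⟩ (fun a => (prodBernoulli u).real (openConnIn ((W : Set (Fin n))ᶜ) a b))) →
      (prodBernoulli u).real (openConn a₀ b)
          + (prodBernoulli u).real
              ((openConn a₀ b)ᶜ ∩ (⋃ v ∈ insert x T, openConn a₀ v) ∩ (⋃ v ∈ insert x T, openConn v b))
        ≤ (prodBernoulli u).real (⋃ v ∈ insert x T, openConn v b)
          + (∑ W ∈ (Finset.univ : Finset (Finset (Fin n))).filter (fun W => Disjoint W A),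
              (prodBernoulli u).real
                  {ω : BondConfig (Fin n) | ∀ z : Fin n, (z ∈ W ↔ ω ∈ ⋃ v ∈ insert x T, openConn v z)}
                * A.inf' ⟨b, hb⟩ (fun a => (prodBernoulli u).real (openConnIn ((W : Set (Fin n))ᶜ) a b))) := by
  intro n
  suffices key : ∀ (N : ℕ) (u : Sym2 (Fin n) → unitInterval),
      (Finset.univ.filter (fun v : Fin n => ∃ y : Fin n, 0 < (u s(y, v) : ℝ))).card = N →
      ∀ (A T : Finset (Fin n)) (b a₀ x : Fin n) (hb : b ∈ A),
      Disjoint T A → T.Nonempty → x ∉ A → x ∉ T → a₀ ∈ A → 4 ≤ A.card →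
      (∀ a ∈ A, (prodBernoulli u).real (openConn a₀ b) ≤ (prodBernoulli u).real (openConn a b)) →
      (∀ v ∈ insert x T, (prodBernoulli u).real (openConn v b) < (prodBernoulli u).real (openConn a₀ b)) →
      (∀ w' : Sym2 (Fin n) → unitInterval,
        (Finset.univ.filter (fun v : Fin n => ∃ y : Fin n, 0 < (w' s(y, v) : ℝ))).card
          ≤ (Finset.univ.filter (fun v : Fin n => ∃ y : Fin n, 0 < (u s(y, v) : ℝ))).card →
        ∀ (A' : Finset (Fin n)) (o' b' : Fin n), b' ∈ A' → o' ∉ A' →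
        ∀ (t : ℝ) (sel : Finset (Fin n) → Fin n), (∀ W, sel W ∈ A') →
          (∀ a ∈ A', 1 - t ≤ (prodBernoulli w').real (openConn a b')) →
          (prodBernoulli w').real ((⋃ a ∈ A', openConn o' a) ∩ (openConn o' b')ᶜ)
            + ∑ W ∈ (Finset.univ : Finset (Finset (Fin n))).filter (fun W => o' ∈ W ∧ Disjoint W A'),
                (prodBernoulli w').real {ω : BondConfig (Fin n) | openCluster ω o' = (W : Set (Fin n))}
                  * (prodBernoulli w').real (openConnIn ((W : Set (Fin n))ᶜ) (sel W) b')ᶜ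
            ≤ t) →
      (prodBernoulli u).real (openConn a₀ b)
          + (prodBernoulli u).real
              ((openConn a₀ b)ᶜ ∩ (⋃ v ∈ T, openConn a₀ v) ∩ (⋃ v ∈ T, openConn v b))
        ≤ (prodBernoulli u).real (⋃ v ∈ T, openConn v b)
          + (∑ W ∈ (Finset.univ : Finset (Finset (Fin n))).filter (fun W => Disjoint W A),
              (prodBernoulli u).real
                  {ω : BondConfig (Fin n) | ∀ z : Fin n, (z ∈ W ↔ ω ∈ ⋃ v ∈ T, openConn v z)}
                * A.inf' ⟨b, hb⟩ (fun a => (prodBernoulli u).real (openConnIn ((W : Set (Fin n))ᶜ) a b))) →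
      (prodBernoulli u).real (openConn a₀ b)
          + (prodBernoulli u).real
              ((openConn a₀ b)ᶜ ∩ (⋃ v ∈ insert x T, openConn a₀ v) ∩ (⋃ v ∈ insert x T, openConn v b))
        ≤ (prodBernoulli u).real (⋃ v ∈ insert x T, openConn v b)
          + (∑ W ∈ (Finset.univ : Finset (Finset (Fin n))).filter (fun W => Disjoint W A),
              (prodBernoulli u).real
                  {ω : BondConfig (Fin n) | ∀ z : Fin n, (z ∈ W ↔ ω ∈ ⋃ v ∈ insert x T, openConn v z)}
                * A.inf' ⟨b, hb⟩ (fun a => (prodBernoulli u).real (openConnIn ((W : Set (Fin n))ᶜ) a b))) by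
    intro u A T b a₀ x hb
    exact key _ u rfl A T b a₀ x hb
  intro N
  induction N using Nat.strong_induction_on with
  | _ N ih =>
    intro u hN A T b a₀ x hb hTA hT hxA hxT ha₀ hA4 hmin hbad hIH hTgood
    obtain ⟨s₀, hs₀⟩ := hT
    have ha₀x : a₀ ≠ x := fun h => hxA (h ▸ ha₀)
    have hSA : Disjoint (insert x T) A := Finset.disjoint_insert_left.2 ⟨hxA, hTA⟩
    -- the star-killed weightings, in the two syntactic forms used by the tree
    have hvK : ∀ x' : Fin n, (fun e : Sym2 (Fin n) => if (∃ y ∈ e, y ∈ ({x'} : Finset (Fin n))) then (0 : unitInterval) else u e)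
        = fun e : Sym2 (Fin n) => if x' ∈ e then (0 : unitInterval) else u e := by
      intro x'
      funext e
      by_cases hxe : x' ∈ e
      · rw [if_pos hxe, if_pos ⟨x', hxe, Finset.mem_singleton_self x'⟩]
      · rw [if_neg hxe, if_neg]
        rintro ⟨y, hy, hyx⟩
        exact hxe ((Finset.mem_singleton.1 hyx) ▸ hy)
    -- THE BYSTANDER ROUTE through an arbitrary non-isolated vertex `x'` of the block
    have route : ∀ x' ∈ insert x T, ∀ y₀ : Fin n, (u s(x', y₀) : ℝ) ≠ 0 → ∀ a' ∈ A,
        (∀ a ∈ A, (prodBernoulli (fun e : Sym2 (Fin n) => if (∃ y ∈ e, y ∈ ({x'} : Finset (Fin n))) then (0 : unitInterval) else u e)).real (openConn a' b) ≤ (prodBernoulli (fun e : Sym2 (Fin n) => if (∃ y ∈ e, y ∈ ({x'} : Finset (Fin n))) then (0 : unitInterval) else u e)).real (openConn a b)) →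
        (prodBernoulli u).real (openConn a' b)
          + (prodBernoulli u).real
              ((openConn a' b)ᶜ ∩ (⋃ v ∈ insert x T, openConn a' v) ∩ (⋃ v ∈ insert x T, openConn v b))
        ≤ (prodBernoulli u).real (⋃ v ∈ insert x T, openConn v b)
          + (∑ W ∈ (Finset.univ : Finset (Finset (Fin n))).filter (fun W => Disjoint W A),
              (prodBernoulli u).real
                  {ω : BondConfig (Fin n) | ∀ z : Fin n, (z ∈ W ↔ ω ∈ ⋃ v ∈ insert x T, openConn v z)}
                * A.inf' ⟨b, hb⟩ (fun a => (prodBernoulli u).real (openConnIn ((W : Set (Fin n))ᶜ) a b))) := by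
      intro x' hx' y₀ hy₀ a' ha'A ha'min
      have hx'A : x' ∉ A := Finset.disjoint_left.1 hSA hx'
      have ha'x : a' ≠ x' := fun h => hx'A (h ▸ ha'A)
      have hins : insert x' ((insert x T).erase x') = insert x T := Finset.insert_erase hx'
      have hx'T' : x' ∉ (insert x T).erase x' := Finset.notMem_erase x' _
      -- a second vertex of the block
      have hT'ne : ((insert x T).erase x').Nonempty := by
        rw [← Finset.card_pos, Finset.card_erase_of_mem hx', Finset.card_insert_of_notMem hxT]
        have : 0 < T.card := Finset.card_pos.2 ⟨s₀, hs₀⟩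
        omega
      obtain ⟨s₁, hs₁⟩ := hT'ne
      have hlt : (Finset.univ.filter (fun v : Fin n => ∃ y : Fin n, 0 < ((fun e : Sym2 (Fin n) => if (∃ y ∈ e, y ∈ ({x'} : Finset (Fin n))) then (0 : unitInterval) else u e) s(y, v) : ℝ))).card
          < (Finset.univ.filter (fun v : Fin n => ∃ y : Fin n, 0 < (u s(y, v) : ℝ))).card := by
        rw [hvK x']
        exact goodStep_card_lt u hy₀
      have hIHv : ∀ w' : Sym2 (Fin n) → unitInterval,
          (Finset.univ.filter (fun v : Fin n => ∃ y : Fin n, 0 < (w' s(y, v) : ℝ))).card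
            ≤ (Finset.univ.filter (fun v : Fin n => ∃ y : Fin n, 0 < ((fun e : Sym2 (Fin n) => if (∃ y ∈ e, y ∈ ({x'} : Finset (Fin n))) then (0 : unitInterval) else u e) s(y, v) : ℝ))).card →
          ∀ (A' : Finset (Fin n)) (o' b' : Fin n), b' ∈ A' → o' ∉ A' →
          ∀ (t : ℝ) (sel : Finset (Fin n) → Fin n), (∀ W, sel W ∈ A') →
            (∀ a ∈ A', 1 - t ≤ (prodBernoulli w').real (openConn a b')) →
            (prodBernoulli w').real ((⋃ a ∈ A', openConn o' a) ∩ (openConn o' b')ᶜ)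
              + ∑ W ∈ (Finset.univ : Finset (Finset (Fin n))).filter (fun W => o' ∈ W ∧ Disjoint W A'),
                  (prodBernoulli w').real {ω : BondConfig (Fin n) | openCluster ω o' = (W : Set (Fin n))}
                    * (prodBernoulli w').real (openConnIn ((W : Set (Fin n))ᶜ) (sel W) b')ᶜ
              ≤ t :=
        fun w' hw' => hIH w' (hw'.trans hlt.le)
      -- cone steps of `u − x'` at `a'`: induction-hypothesis instances
      have hconeV : ∀ (T' : Finset (Fin n)) (x'' : Fin n), Disjoint T' A → T'.Nonempty → x'' ∉ A → x'' ∉ T' →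
          (∀ v ∈ insert x'' T', (prodBernoulli (fun e : Sym2 (Fin n) => if (∃ y ∈ e, y ∈ ({x'} : Finset (Fin n))) then (0 : unitInterval) else u e)).real (openConn v b)
            < (prodBernoulli (fun e : Sym2 (Fin n) => if (∃ y ∈ e, y ∈ ({x'} : Finset (Fin n))) then (0 : unitInterval) else u e)).real (openConn a' b)) →
          (prodBernoulli (fun e : Sym2 (Fin n) => if (∃ y ∈ e, y ∈ ({x'} : Finset (Fin n))) then (0 : unitInterval) else u e)).real (openConn a' b)
          + (prodBernoulli (fun e : Sym2 (Fin n) => if (∃ y ∈ e, y ∈ ({x'} : Finset (Fin n))) then (0 : unitInterval) else u e)).real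
              ((openConn a' b)ᶜ ∩ (⋃ v ∈ T', openConn a' v) ∩ (⋃ v ∈ T', openConn v b))
        ≤ (prodBernoulli (fun e : Sym2 (Fin n) => if (∃ y ∈ e, y ∈ ({x'} : Finset (Fin n))) then (0 : unitInterval) else u e)).real (⋃ v ∈ T', openConn v b)
          + (∑ W ∈ (Finset.univ : Finset (Finset (Fin n))).filter (fun W => Disjoint W A),
              (prodBernoulli (fun e : Sym2 (Fin n) => if (∃ y ∈ e, y ∈ ({x'} : Finset (Fin n))) then (0 : unitInterval) else u e)).real
                  {ω : BondConfig (Fin n) | ∀ z : Fin n, (z ∈ W ↔ ω ∈ ⋃ v ∈ T', openConn v z)}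
                * A.inf' ⟨b, hb⟩ (fun a => (prodBernoulli (fun e : Sym2 (Fin n) => if (∃ y ∈ e, y ∈ ({x'} : Finset (Fin n))) then (0 : unitInterval) else u e)).real (openConnIn ((W : Set (Fin n))ᶜ) a b))) →
          (prodBernoulli (fun e : Sym2 (Fin n) => if (∃ y ∈ e, y ∈ ({x'} : Finset (Fin n))) then (0 : unitInterval) else u e)).real (openConn a' b)
          + (prodBernoulli (fun e : Sym2 (Fin n) => if (∃ y ∈ e, y ∈ ({x'} : Finset (Fin n))) then (0 : unitInterval) else u e)).real
              ((openConn a' b)ᶜ ∩ (⋃ v ∈ insert x'' T', openConn a' v) ∩ (⋃ v ∈ insert x'' T', openConn v b))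
        ≤ (prodBernoulli (fun e : Sym2 (Fin n) => if (∃ y ∈ e, y ∈ ({x'} : Finset (Fin n))) then (0 : unitInterval) else u e)).real (⋃ v ∈ insert x'' T', openConn v b)
          + (∑ W ∈ (Finset.univ : Finset (Finset (Fin n))).filter (fun W => Disjoint W A),
              (prodBernoulli (fun e : Sym2 (Fin n) => if (∃ y ∈ e, y ∈ ({x'} : Finset (Fin n))) then (0 : unitInterval) else u e)).real
                  {ω : BondConfig (Fin n) | ∀ z : Fin n, (z ∈ W ↔ ω ∈ ⋃ v ∈ insert x'' T', openConn v z)}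
                * A.inf' ⟨b, hb⟩ (fun a => (prodBernoulli (fun e : Sym2 (Fin n) => if (∃ y ∈ e, y ∈ ({x'} : Finset (Fin n))) then (0 : unitInterval) else u e)).real (openConnIn ((W : Set (Fin n))ᶜ) a b))) :=
        fun T' x'' hT'A hT' hx''A hx''T' hbad' hgood' =>
          ih _ (hN ▸ hlt) _ rfl A T' b a' x'' hb hT'A hT' hx''A hx''T' ha'A hA4 ha'min hbad' hIHv hgood'
      rw [← hins]
      refine hInsert n u A ((insert x T).erase x') x' b a' hb hx'T' hx'A ha'x fun B _ => ?_
      by_cases hbTB : b ∈ (insert x T).erase x' ∪ B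
      · exact coneDD_blockGood_of_target_mem _ A _ b a' hb hbTB
      by_cases hleaf : ∃ w ∈ (insert x T).erase x' ∪ B, (prodBernoulli (fun e : Sym2 (Fin n) => if (∃ y ∈ e, y ∈ ({x'} : Finset (Fin n))) then (0 : unitInterval) else u e)).real (openConn a' b)
          ≤ (prodBernoulli (fun e : Sym2 (Fin n) => if (∃ y ∈ e, y ∈ ({x'} : Finset (Fin n))) then (0 : unitInterval) else u e)).real (openConn w b)
      · obtain ⟨w, hw, hle⟩ := hleaf
        have hex : ∀ W : Finset (Fin n), ∃ a, a ∈ A ∧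
            A.inf' ⟨b, hb⟩ (fun a => (prodBernoulli (fun e : Sym2 (Fin n) => if (∃ y ∈ e, y ∈ ({x'} : Finset (Fin n))) then (0 : unitInterval) else u e)).real (openConnIn ((W : Set (Fin n))ᶜ) a b)) =
              (prodBernoulli (fun e : Sym2 (Fin n) => if (∃ y ∈ e, y ∈ ({x'} : Finset (Fin n))) then (0 : unitInterval) else u e)).real (openConnIn ((W : Set (Fin n))ᶜ) a b) :=
          fun W => Finset.exists_mem_eq_inf' ⟨b, hb⟩ _
        choose selm hselmA hselm using hex
        have h5 := blockGood_leaf_lemma5 (fun e : Sym2 (Fin n) => if (∃ y ∈ e, y ∈ ({x'} : Finset (Fin n))) then (0 : unitInterval) else u e) A ((insert x T).erase x' ∪ B) b a' w selm hw hbTB hle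
        have hsum : ∑ W ∈ (Finset.univ : Finset (Finset (Fin n))).filter (fun W => Disjoint W A),
            (prodBernoulli (fun e : Sym2 (Fin n) => if (∃ y ∈ e, y ∈ ({x'} : Finset (Fin n))) then (0 : unitInterval) else u e)).real
                {ω : BondConfig (Fin n) | ∀ z : Fin n, (z ∈ W ↔ ω ∈ ⋃ v ∈ (insert x T).erase x' ∪ B, openConn v z)}
              * (prodBernoulli (fun e : Sym2 (Fin n) => if (∃ y ∈ e, y ∈ ({x'} : Finset (Fin n))) then (0 : unitInterval) else u e)).real (openConnIn ((W : Set (Fin n))ᶜ) (selm W) b)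
            = ∑ W ∈ (Finset.univ : Finset (Finset (Fin n))).filter (fun W => Disjoint W A),
                (prodBernoulli (fun e : Sym2 (Fin n) => if (∃ y ∈ e, y ∈ ({x'} : Finset (Fin n))) then (0 : unitInterval) else u e)).real
                    {ω : BondConfig (Fin n) | ∀ z : Fin n, (z ∈ W ↔ ω ∈ ⋃ v ∈ (insert x T).erase x' ∪ B, openConn v z)}
                  * A.inf' ⟨b, hb⟩ (fun a => (prodBernoulli (fun e : Sym2 (Fin n) => if (∃ y ∈ e, y ∈ ({x'} : Finset (Fin n))) then (0 : unitInterval) else u e)).real (openConnIn ((W : Set (Fin n))ᶜ) a b)) := by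
          refine Finset.sum_congr rfl fun W _ => ?_
          rw [hselm W]
        rw [hsum] at h5
        exact h5
      · push Not at hleaf
        have hdisj : Disjoint ((insert x T).erase x' ∪ B) A :=
          Finset.disjoint_left.2 fun w hw hwA => absurd (ha'min w hwA) (not_le.2 (hleaf w hw))
        exact coneDD_chain_local _ A _ b a' s₁ hb hdisj (Finset.mem_union_left B hs₁) ha'min hleaf hIHv hconeV
    by_cases hiso : ∀ y : Fin n, (u s(x, y) : ℝ) = 0
    · -- isolated bystander: `u − x = u`, and the only layer of positive mass is `B = ∅`
      have hvu : (fun e : Sym2 (Fin n) => if (∃ y ∈ e, y ∈ ({x} : Finset (Fin n))) then (0 : unitInterval) else u e) = u := by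
        rw [hvK x]
        funext e
        by_cases hxe : x ∈ e
        · rw [if_pos hxe]
          obtain ⟨y, rfl⟩ := Sym2.mem_iff_exists.1 hxe
          exact (Set.Icc.coe_eq_zero.1 (hiso y)).symm
        · rw [if_neg hxe]
      refine hInsert n u A T x b a₀ hb hxT hxA ha₀x fun B hB0 => ?_
      have hBempty : B = ∅ := by
        by_contra hne
        obtain ⟨y, hy⟩ := Finset.nonempty_iff_ne_empty.2 hne
        obtain ⟨-, o, ho, hne0⟩ := sigmaRec_posLayer u u {x} B (fun _ _ _ => rfl) hB0 y hy
        rw [Finset.mem_singleton] at ho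
        subst ho
        exact hne0 (Set.Icc.coe_eq_zero.1 (hiso y))
      subst hBempty
      rw [Finset.union_empty, hvu]
      exact hTgood
    · -- a genuine bystander: try every vertex of the block as the bystander, else the double-drift residual
      push Not at hiso
      obtain ⟨y₀, hy₀⟩ := hiso
      by_cases hgood : ∃ x' ∈ insert x T, ∃ y₁ : Fin n, (u s(x', y₁) : ℝ) ≠ 0 ∧ ∃ a' ∈ A,
          (∀ a ∈ A, (prodBernoulli (fun e : Sym2 (Fin n) => if (∃ y ∈ e, y ∈ ({x'} : Finset (Fin n))) then (0 : unitInterval) else u e)).real (openConn a' b) ≤ (prodBernoulli (fun e : Sym2 (Fin n) => if (∃ y ∈ e, y ∈ ({x'} : Finset (Fin n))) then (0 : unitInterval) else u e)).real (openConn a b)) ∧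
          (prodBernoulli u).real (openConn a₀ b)
            + (prodBernoulli u).real ((openConn a₀ b)ᶜ ∩ (⋃ v ∈ insert x T, openConn a₀ v) ∩ (⋃ v ∈ insert x T, openConn v b))
          ≤ (prodBernoulli u).real (openConn a' b)
            + (prodBernoulli u).real ((openConn a' b)ᶜ ∩ (⋃ v ∈ insert x T, openConn a' v) ∩ (⋃ v ∈ insert x T, openConn v b))
      · obtain ⟨x', hx', y₁, hy₁, a', ha'A, ha'min, hle⟩ := hgood
        have := route x' hx' y₁ hy₁ a' ha'A ha'min
        linarith
      · push Not at hgood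
        exact hDD n u A T b a₀ x hb hTA ⟨s₀, hs₀⟩ hxA hxT ha₀ hA4 hmin hbad hIH hTgood
          (fun x' hx' y₁ hy₁ a' ha'A ha'min => hgood x' hx' y₁ hy₁ a' ha'A ha'min) route

/-- Registered stub `stub_coneDDStarKill_c5` of crux stmt-CriticalPhenomena-4576 (lead c5, skeleton v4, part 2/2 — the registration
handle of this file, whose content theorem `coneDD_conePeel_of` has a signature beyond the registry's limit; the crux by name is
`coneLine_additiveGluing_of (coneDD_conePeel_of h₁ h₂)`): the two tree spellings of the star-killed weighting agree. [folklore] -/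
theorem stub_coneDDStarKill_c5 : ∀ (n : ℕ) (u : Sym2 (Fin n) → unitInterval) (x : Fin n),
    (fun e : Sym2 (Fin n) => if (∃ y ∈ e, y ∈ ({x} : Finset (Fin n))) then (0 : unitInterval) else u e)
      = fun e : Sym2 (Fin n) => if x ∈ e then (0 : unitInterval) else u e := by
  intro n u x
  funext e
  by_cases hxe : x ∈ e
  · rw [if_pos hxe, if_pos ⟨x, hxe, Finset.mem_singleton_self x⟩]
  · rw [if_neg hxe, if_neg]
    rintro ⟨y, hy, hyx⟩
    exact hxe ((Finset.mem_singleton.1 hyx) ▸ hy)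

end

end Summit.CriticalPhenomena.PercolationContinuityZ3.Theorems
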